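import Literature.Barriers.CriticalPhenomena.PlaquetteWalkHoleRootCutMarkingDoors
import HarnessLib

/-!
# Barrier catalogue (SAWScalingLimit): DEAD ENDS ARE DEAD — the cut law and the marking law with «uncrossed» edges; the door of a
dead-end cell is never crossed

Leaf of `PlaquetteWalkHoleRootCutMarkingDoors` (cut law, marking law, four-doors law). The cut law only ever uses DEAD edges through
«no mid-edge of the walk equals this edge». This file restates the criterion and the marking law with that weaker, per-walk
hypothesis — an edge is UNCROSSED by `ω` if `nth i ≠ e` for `1 ≤ i ≤ length` — and supplies the second source of uncrossed edges
after dead ones: ★★★★ `ΩG.nth_ne_side_of_deadEnd` — the one door of a DEAD-END cell `g` (a cell other than the root plaquette and the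
far cell whose three other sides are dead) is never a mid-edge of a walk to the far cell: an arc in `g` would need a second live side.
This is the «dead-end clause» of the lane's kill chains (`PlaquetteWalkHoleRootStructuralKill` §7 `ΩG.fc_ne_of_deadEnd`,
`PlaquetteWalkHoleRootEastDeadEnd` `ΩG.fc_ne_of_deadEndE`, `StructuralKillQuadrant` §2) in the cut vocabulary.

§1 ★★★★ `ΩG.AJ_root_eq_zero_of_cut_uncrossed` / `ΩG.WE_eq_…` — ONE-CROSSABLE-EDGE CRITERION: a cut from the lower corner of the root
edge to beyond the domain on which at most one edge can be a mid-edge of the walk ⇒ the walk (an under-walk) is unwound.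
§2 ★★★★ `ΩG.prefix_and_exit_of_twoCrossable_cut`, ★★★★★ `ΩG.kindsIn_eq_corner_corner_of_twoCrossable_cut` /
`…_coCorner_coCorner_…` — the marking law with all other edges merely uncrossed.
§3 ★★★★ `ΩG.nth_ne_side_of_deadEnd` (dead ends are dead) and `ΩG.nth_ne_of_faces_not_mem` (dead edges are uncrossed), the two
dischargers.
§4 Instance (general `D`): ★★★★★ `ΩG.kindsIn_farSW_eq_of_AJ_ne_zero_under_swColumn_deadEnds` — `K_S2`'s kill with the far cell's
column below the kill row closed by DEAD OR DEAD-END cells: for every row `y` from the floor to `w.2 − 3`, the west side of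
`(w.1 − 2, y)` is dead OR the cell `(w.1 − 3, y)` behind it is a dead end (its `W`, `S`, `N` neighbours absent) — the hypothesis of
`StructuralKill`'s `kindsIn_farSW_eq_of_wound_under_deadEnd`, here with a floor, from the marking law in forty lines.

Not in print; venture lane «pcv-sawmu», seat b-step0 gen 29 (FINDING-YB-KILL-FORCED-ZEROS §28).

References: A. Glazman, I. Manolescu, arXiv:1708.00395v3, §1 (Fig. 1), §2.1, Lemma 2.1 [GlazmanManolescu2019]; A. Glazman, Electron.
Commun. Probab. 20 (2015) no. 86, Lemma 3.1, proof pp. 6–7 [Glazman2015WeightedSAW]; R. Courant, H. Robbins, *What is Mathematics?*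
(1941/1958), Ch. V Appendix §2 (the even–odd rule) [CourantRobbins1958].
-/

noncomputable section

open Set Function Complex
open Literature.Topology.PlaneTopology

namespace Literature.Probability.RandomPlanarGeometry.SAW.YangBaxter

open Real

open private fc_fh from Literature.Probability.RandomPlanarGeometry.YangBaxterSAWGeneralDomain
open private len_eq side_jOut from Literature.Probability.RandomPlanarGeometry.YangBaxterSAWExcursionJordan

namespace ΩG

variable {D : Set Face} {w : Face} {ω : ΩG D (w.side .W) (farW w)}

/-! ## §3 (first, for use below) The two dischargers: dead edges and dead-end doors are uncrossed -/

/-- **A dead edge is uncrossed**: if a face of `e` is absent, `nth i ≠ e` for `1 ≤ i ≤ length`.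
[cite: Glazman2015WeightedSAW, Lemma 3.1 (proof, pp. 6–7: the classes of walks through a rhombus)] -/
theorem nth_ne_of_faces_not_mem (hr : RootedFace D (w.side .W) (farW w)) (h : ω.IsB2a) {e : MidEdge}
    (he : e.faces.1 ∉ D ∨ e.faces.2 ∉ D) : ∀ i, 1 ≤ i → i ≤ ω.2.arcs.length → ω.2.nth i ≠ e := by
  intro i hi1 hi hie
  have hl := faces_mem_of_nth hr h hi1 hi
  rw [hie] at hl
  rcases he with he | he
  · exact he hl.1
  · exact he hl.2

/-- ★★★★ **DEAD ENDS ARE DEAD.** Let `g` be a cell other than the root plaquette `w` and the far cell, and `s` a side of `g` such that every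
OTHER side of `g` is dead (a face absent). Then the side `s` of `g` is never a mid-edge of a class-`B2a` walk to the far cell: an arc of the
walk in `g` would have a second end, a live side. [cite: Glazman2015WeightedSAW, Lemma 3.1 (proof, pp. 6–7: the classes of walks through a rhombus)]
[cite: GlazmanManolescu2019, §1, Fig. 1 (an arc joins two sides of its rhombus)] -/
theorem nth_ne_side_of_deadEnd (hh : holeFaceW w ∉ D) (hr : RootedFace D (w.side .W) (farW w)) (h : ω.IsB2a) {g : Face}
    (hgw : g ≠ w)
    (hgf : g ≠ farW w) {s : Side} (hdead : ∀ t : Side, t ≠ s → (g.side t).faces.1 ∉ D ∨ (g.side t).faces.2 ∉ D) :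
    ∀ i, 1 ≤ i → i ≤ ω.2.arcs.length → ω.2.nth i ≠ g.side s := by
  intro i hi1 hi e
  have hF := ω.fh_lt h
  have hM := ω.three_le_Mv hr h
  have hlen : ω.2.arcs.length = ω.2.firstHitG + ω.Mv := len_eq h
  -- an arc of the walk in `g` with the end `s`
  obtain ⟨m, hmn, hfm, hs⟩ : ∃ m, m < ω.2.arcs.length ∧ ω.2.fc m = g ∧ (ω.2.sIn m = s ∨ ω.2.sOut m = s) := by
    rcases Nat.lt_or_ge i ω.2.arcs.length with hlt | hge
    · obtain ⟨m, hm, hfm, hs⟩ := exists_arc_of_nth_eq (ω := ω) hi1 hlt e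
      exact ⟨m, by rcases hm with em | em <;> omega, hfm, hs⟩
    · -- the last mid-edge: an exit mid-edge of the last slot
      have heq : i = ω.2.arcs.length := by omega
      have hj : ω.Mv - 1 < ω.Mv := by omega
      have e' : (ω.jFace h (ω.Mv - 1)).side (ω.jOut hr h (ω.Mv - 1)) = g.side s := by
        rw [side_jOut (hr := hr) h hj, show ω.2.firstHitG + (ω.Mv - 1) + 1 = ω.2.arcs.length by omega, ← heq, e]
      obtain ⟨m, -, hmn, hfm, hs⟩ := exists_excursion_arc_of_exit_eq hr h hj hgf e'
      exact ⟨m, hmn, hfm, hs⟩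
  -- its other end is a live side of `g`
  obtain ⟨hin, hout, hio⟩ := ω.2.side_sIn_nth (i := m) hmn
  rw [hfm] at hin hout
  have hm0 : m ≠ 0 := by
    intro hm0
    subst hm0
    exact hgw (hfm.symm.trans (fc_zero_eq_root (w := w) hh ω.2 (by omega)))
  rcases hs with hs | hs
  · -- the other end is `sOut m`
    have ht : ω.2.sOut m ≠ s := fun e2 => hio (hs.trans e2.symm)
    have hl := faces_mem_of_nth hr h (j := m + 1) (by omega) (by omega)
    rw [← hout] at hl
    rcases hdead _ ht with hd | hd
    · exact hd hl.1
    · exact hd hl.2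
  · have ht : ω.2.sIn m ≠ s := fun e2 => hio (e2.trans hs.symm)
    have hl := faces_mem_of_nth hr h (j := m) (by omega) (by omega)
    rw [← hin] at hl
    rcases hdead _ ht with hd | hd
    · exact hd hl.1
    · exact hd hl.2

/-! ## §1 The one-crossable-edge criterion -/

/-- ★★★★ **ONE-CROSSABLE-EDGE CRITERION.** Hole absent; a lattice cut `q 0 = (w.1, w.2), …, q K` ending beyond the domain, edges neither
the hole's `W` side nor the root edge; `ω` a class-`B2a` UNDER-walk such that every edge of the cut except possibly the `i₀`-th is
UNCROSSED by `ω` (`nth i ≠ e` for `1 ≤ i ≤ length`; dischargers `nth_ne_of_faces_not_mem`, `nth_ne_side_of_deadEnd`). Then the excursion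
polygon of `ω` does not wind around the root. [cite: CourantRobbins1958, Ch. V Appendix §2 (the even–odd rule)]
[cite: AhlforsCA1979, Ch. 4 §2.1 (index of a point)] [cite: Glazman2015WeightedSAW, Lemma 3.1 (proof, pp. 6–7)] -/
theorem AJ_root_eq_zero_of_cut_uncrossed (hh : holeFaceW w ∉ D) (hr : RootedFace D (w.side .W) (farW w)) (h : ω.IsB2a)
    (hS : ω.2.firstSideG = .S) {q : ℕ → ℤ × ℤ} {c : ℕ → Face} {s : ℕ → Side} {K : ℕ} (hq0 : q 0 = w)
    (hseg : ∀ k, k < K → segment ℝ (toC (cornerPt (q k))) (toC (cornerPt (q (k + 1)))) = sideSeg (c k) (s k))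
    (h1 : ∀ k, k < K → (c k).side (s k) ≠ (holeFaceW w).side .W) (h2 : ∀ k, k < K → (c k).side (s k) ≠ w.side .W)
    (hexit : (∀ f : Face, f ∈ D → f.1 < (q K).1) ∨ (∀ f : Face, f ∈ D → (q K).1 ≤ f.1) ∨
      (∀ f : Face, f ∈ D → (q K).2 ≤ f.2) ∨ (∀ f : Face, f ∈ D → f.2 < (q K).2))
    {i₀ : ℕ} (hunc : ∀ k, k < K → k ≠ i₀ → ∀ i, 1 ≤ i → i ≤ ω.2.arcs.length → ω.2.nth i ≠ (c k).side (s k)) :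
    ω.AJ hr h (toC (midPt (w.side .W))) = 0 := by
  by_contra hA
  have hF := ω.fh_lt h
  have hlen : ω.2.arcs.length = ω.2.firstHitG + ω.Mv := len_eq h
  obtain ⟨i, k, hik, hk, ⟨i', hi1, hiF, e⟩, j, hj, e'⟩ :=
    exists_prefix_lt_exit_on_cut hh hr h hS hq0 hseg h1 h2 (AJ_cornerPt_eq_zero_of_beyond hr h hexit) hA
  rw [side_jOut (hr := hr) h hj] at e'
  have hi0 : i = i₀ := by
    by_contra hn
    exact hunc i (by omega) hn i' hi1 (by omega) e
  have hk0 : k = i₀ := by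
    by_contra hn
    exact hunc k hk hn (ω.2.firstHitG + j + 1) (by omega) (by omega) e'
  omega

/-- ★★★★ **ONE-CROSSABLE-EDGE CRITERION, winding form**: if for EVERY class-`B2a` under-walk at the far cell all edges of the cut but the
`i₀`-th are uncrossed, no such walk is wound (either orientation of the witness; the reversed companion has the same mid-edges).
[cite: GlazmanManolescu2019, Lemma 2.1 (statement, "in the form given in [Gl]"), §1 (Fig. 2)]
[cite: Glazman2015WeightedSAW, Lemma 3.1 (proof, pp. 6–7)] [cite: CourantRobbins1958, Ch. V Appendix §2 (the even–odd rule)] -/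
theorem WE_eq_excursionWinding_of_under_cut_uncrossed (hh : holeFaceW w ∉ D) {q : ℕ → ℤ × ℤ} {c : ℕ → Face} {s : ℕ → Side}
    {K : ℕ} (hq0 : q 0 = w)
    (hseg : ∀ k, k < K → segment ℝ (toC (cornerPt (q k))) (toC (cornerPt (q (k + 1)))) = sideSeg (c k) (s k))
    (h1 : ∀ k, k < K → (c k).side (s k) ≠ (holeFaceW w).side .W) (h2 : ∀ k, k < K → (c k).side (s k) ≠ w.side .W)
    (hexit : (∀ f : Face, f ∈ D → f.1 < (q K).1) ∨ (∀ f : Face, f ∈ D → (q K).1 ≤ f.1) ∨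
      (∀ f : Face, f ∈ D → (q K).2 ≤ f.2) ∨ (∀ f : Face, f ∈ D → f.2 < (q K).2))
    {i₀ : ℕ} (hunc : ∀ (ω : ΩG D (w.side .W) (farW w)) (h : ω.IsB2a), ∀ k, k < K → k ≠ i₀ →
      ∀ i, 1 ≤ i → i ≤ ω.2.arcs.length → ω.2.nth i ≠ (c k).side (s k))
    (ω : ΩG D (w.side .W) (farW w)) (hr : RootedFace D (w.side .W) (farW w)) (h : ω.IsB2a)
    (hS : ω.2.firstSideG = .S) (θ : ℝ) :
    ω.WE (fun _ => θ) = excursionWinding θ ω.2.firstSideG (ω.z1 hr h) ω.1 := by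
  by_contra hW
  rcases ω.AJ_ne_zero_or_rev_of_wound hr h θ hW with hA | hA
  · exact hA (AJ_root_eq_zero_of_cut_uncrossed hh hr h hS hq0 hseg h1 h2 hexit (hunc ω h))
  · have h' := ω.rev_isB2a hr h
    have hS' : (ω.rev hr).2.firstSideG = .S := by rw [ω.rev_firstSide hr h]; exact hS
    exact hA (AJ_root_eq_zero_of_cut_uncrossed hh hr h' hS' hq0 hseg h1 h2 hexit (hunc (ω.rev hr) h'))

/-! ## §2 Localisation and the marking law with uncrossed edges -/

/-- ★★★★ **LOCALISATION, uncrossed form**: all edges of the cut except the `i`-th and the `k`-th (`i < k`) uncrossed by `ω` ⇒ (if `ω`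
winds) the prefix crosses the `i`-th and a slot exits through the `k`-th. [cite: CourantRobbins1958, Ch. V Appendix §2 (the even–odd rule)]
[cite: Glazman2015WeightedSAW, Lemma 3.1 (proof, pp. 6–7)] -/
theorem prefix_and_exit_of_twoCrossable_cut (hh : holeFaceW w ∉ D) (hr : RootedFace D (w.side .W) (farW w)) (h : ω.IsB2a)
    (hS : ω.2.firstSideG = .S) {q : ℕ → ℤ × ℤ} {c : ℕ → Face} {s : ℕ → Side} {K : ℕ} (hq0 : q 0 = w)
    (hseg : ∀ k, k < K → segment ℝ (toC (cornerPt (q k))) (toC (cornerPt (q (k + 1)))) = sideSeg (c k) (s k))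
    (h1 : ∀ k, k < K → (c k).side (s k) ≠ (holeFaceW w).side .W) (h2 : ∀ k, k < K → (c k).side (s k) ≠ w.side .W)
    (hexit : (∀ f : Face, f ∈ D → f.1 < (q K).1) ∨ (∀ f : Face, f ∈ D → (q K).1 ≤ f.1) ∨
      (∀ f : Face, f ∈ D → (q K).2 ≤ f.2) ∨ (∀ f : Face, f ∈ D → f.2 < (q K).2))
    {i k : ℕ} (hik : i < k)
    (hunc : ∀ k', k' < K → k' ≠ i → k' ≠ k → ∀ n, 1 ≤ n → n ≤ ω.2.arcs.length → ω.2.nth n ≠ (c k').side (s k'))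
    (hA : ω.AJ hr h (toC (midPt (w.side .W))) ≠ 0) :
    (∃ i', 1 ≤ i' ∧ i' ≤ ω.2.firstHitG ∧ ω.2.nth i' = (c i).side (s i)) ∧
      ∃ j, j < ω.Mv ∧ (ω.jFace h j).side (ω.jOut hr h j) = (c k).side (s k) := by
  have hF := ω.fh_lt h
  have hlen : ω.2.arcs.length = ω.2.firstHitG + ω.Mv := len_eq h
  obtain ⟨i₁, k₁, hik₁, hk₁, ⟨i', hi1, hiF, e⟩, j, hj, e'⟩ :=
    exists_prefix_lt_exit_on_cut hh hr h hS hq0 hseg h1 h2 (AJ_cornerPt_eq_zero_of_beyond hr h hexit) hA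
  have e'' := e'
  rw [side_jOut (hr := hr) h hj] at e''
  have hi₁ : i₁ = i ∨ i₁ = k := by
    by_contra hn; push Not at hn
    exact hunc i₁ (by omega) hn.1 hn.2 i' hi1 (by omega) e
  have hk₁' : k₁ = i ∨ k₁ = k := by
    by_contra hn; push Not at hn
    exact hunc k₁ hk₁ hn.1 hn.2 (ω.2.firstHitG + j + 1) (by omega) (by omega) e''
  have ei : i₁ = i := by rcases hi₁ with e1 | e1 <;> rcases hk₁' with e2 | e2 <;> omega
  have ek : k₁ = k := by rcases hi₁ with e1 | e1 <;> rcases hk₁' with e2 | e2 <;> omega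
  subst ei; subst ek
  exact ⟨⟨i', hi1, hiF, e⟩, j, hj, e'⟩

/-- A dead edge in the sense of the parent (a face absent) gives the parent's `hdead`; an uncrossed-edge family gives it only walk by walk.
Bridge: the parent's marking law applied with the two crossable edges, the other edges dead OR uncrossed — we re-run its proof through
`prefix_and_exit_of_twoCrossable_cut`. [cite: GlazmanManolescu2019, §1, Fig. 1] -/
theorem exists_two_arcs_of_twoCrossable_cut (hh : holeFaceW w ∉ D) (hr : RootedFace D (w.side .W) (farW w)) (h : ω.IsB2a)
    (hS : ω.2.firstSideG = .S) {q : ℕ → ℤ × ℤ} {c : ℕ → Face} {s : ℕ → Side} {K : ℕ} (hq0 : q 0 = w)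
    (hseg : ∀ k, k < K → segment ℝ (toC (cornerPt (q k))) (toC (cornerPt (q (k + 1)))) = sideSeg (c k) (s k))
    (h1 : ∀ k, k < K → (c k).side (s k) ≠ (holeFaceW w).side .W) (h2 : ∀ k, k < K → (c k).side (s k) ≠ w.side .W)
    (hexit : (∀ f : Face, f ∈ D → f.1 < (q K).1) ∨ (∀ f : Face, f ∈ D → (q K).1 ≤ f.1) ∨
      (∀ f : Face, f ∈ D → (q K).2 ≤ f.2) ∨ (∀ f : Face, f ∈ D → f.2 < (q K).2))
    {i k : ℕ} (hik : i < k)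
    (hunc : ∀ k', k' < K → k' ≠ i → k' ≠ k → ∀ n, 1 ≤ n → n ≤ ω.2.arcs.length → ω.2.nth n ≠ (c k').side (s k'))
    {g : Face} (hg : g ≠ farW w) {x y : Side} (hci : (c i).side (s i) = g.side x) (hck : (c k).side (s k) = g.side y)
    (hA : ω.AJ hr h (toC (midPt (w.side .W))) ≠ 0) :
    ∃ m m', m + 1 ≤ ω.2.firstHitG ∧ ω.2.firstHitG + 1 ≤ m' ∧ m' < ω.2.arcs.length ∧ ω.2.fc m = g ∧ ω.2.fc m' = g ∧
      (ω.2.sIn m = x ∨ ω.2.sOut m = x) ∧ ω.2.sIn m ≠ y ∧ ω.2.sOut m ≠ y ∧ ω.2.sIn m ≠ ω.2.sOut m ∧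
      (ω.2.sIn m' = y ∨ ω.2.sOut m' = y) ∧ ω.2.sIn m' ≠ x ∧ ω.2.sOut m' ≠ x ∧ ω.2.sIn m' ≠ ω.2.sOut m' ∧
      ((ω.2.kindsIn g = [.corner, .corner] ∧ arcKind (ω.2.sIn m) (ω.2.sOut m) = .corner ∧
          arcKind (ω.2.sIn m') (ω.2.sOut m') = .corner) ∨
        (ω.2.kindsIn g = [.coCorner, .coCorner] ∧ arcKind (ω.2.sIn m) (ω.2.sOut m) = .coCorner ∧
          arcKind (ω.2.sIn m') (ω.2.sOut m') = .coCorner)) := by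
  have hF := ω.fh_lt h
  have hlen : ω.2.arcs.length = ω.2.firstHitG + ω.Mv := len_eq h
  obtain ⟨⟨i', hi1, hiF, e⟩, j, hj, e'⟩ :=
    prefix_and_exit_of_twoCrossable_cut hh hr h hS hq0 hseg h1 h2 hexit hik hunc hA
  rw [hci] at e
  rw [hck] at e'
  obtain ⟨m, hmF, hfm, hx⟩ := exists_prefix_arc_of_nth_eq hr h hi1 hiF hg e
  obtain ⟨m', hm'F, hm'n, hfm', hy⟩ := exists_excursion_arc_of_exit_eq hr h hj hg e'
  obtain ⟨hin, hout, hio⟩ := ω.2.side_sIn_nth (i := m) (by omega)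
  obtain ⟨hin', hout', hio'⟩ := ω.2.side_sIn_nth (i := m') hm'n
  rw [hfm] at hin hout
  rw [hfm'] at hin' hout'
  have ey : g.side y = ω.2.nth (ω.2.firstHitG + j + 1) := by rw [← e', side_jOut (hr := hr) h hj]
  have hmy1 : ω.2.sIn m ≠ y := by
    intro hc; rw [hc, ey] at hin
    have := ω.2.nth_inj (by omega) (by omega) hin; omega
  have hmy2 : ω.2.sOut m ≠ y := by
    intro hc; rw [hc, ey] at hout
    have := ω.2.nth_inj (by omega) (by omega) hout; omega
  have hmx1 : ω.2.sIn m' ≠ x := by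
    intro hc; rw [hc, ← e] at hin'
    have := ω.2.nth_inj (by omega) (by omega) hin'; omega
  have hmx2 : ω.2.sOut m' ≠ x := by
    intro hc; rw [hc, ← e] at hout'
    have := ω.2.nth_inj (by omega) (by omega) hout'; omega
  refine ⟨m, m', hmF, hm'F, hm'n, hfm, hfm', hx, hmy1, hmy2, hio, hy, hmx1, hmx2, hio', ?_⟩
  have k1 := ω.2.arcKind_eq_of_two_arcs (m := m) (m' := m') (by omega) hm'n (by omega) (hfm'.trans hfm.symm)
    (n := m) (by omega) rfl
  have k2 := ω.2.arcKind_eq_of_two_arcs (m := m) (m' := m') (by omega) hm'n (by omega) (hfm'.trans hfm.symm)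
    (n := m') hm'n (hfm'.trans hfm.symm)
  rw [hfm] at k1 k2
  rcases k1 with ⟨e1, a1⟩ | ⟨e1, a1⟩ <;> rcases k2 with ⟨e2, a2⟩ | ⟨e2, a2⟩
  · exact Or.inl ⟨e1, a1, a2⟩
  · rw [e1] at e2; exact absurd e2 (by decide)
  · rw [e1] at e2; exact absurd e2 (by decide)
  · exact Or.inr ⟨e1, a1, a2⟩

/-- Side bookkeeping (as in the parent). [cite: GlazmanManolescu2019, §1, Fig. 1] -/
private theorem arcKind_ne_coCorner_of_adjD : ∀ x y u v : Side,
    ((x = .N ∧ y = .E) ∨ (x = .E ∧ y = .N) ∨ (x = .S ∧ y = .W) ∨ (x = .W ∧ y = .S)) →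
      (u = x ∨ v = x) → u ≠ y → v ≠ y → u ≠ v → arcKind u v ≠ .coCorner := by
  decide

/-- Side bookkeeping (as in the parent). [cite: GlazmanManolescu2019, §1, Fig. 1] -/
private theorem arcKind_ne_corner_of_adjD : ∀ x y u v : Side,
    ((x = .N ∧ y = .W) ∨ (x = .W ∧ y = .N) ∨ (x = .S ∧ y = .E) ∨ (x = .E ∧ y = .S)) →
      (u = x ∨ v = x) → u ≠ y → v ≠ y → u ≠ v → arcKind u v ≠ .corner := by
  decide

/-- ★★★★★ **THE MARKING LAW, uncrossed form, `θ`-corners**: `{x, y} = {N, E}` or `{S, W}` ⇒ `kindsIn g = [corner, corner]`.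
[cite: GlazmanManolescu2019, §1, Fig. 1 (two arcs at the two θ-corners weigh w₁)]
[cite: Glazman2015WeightedSAW, Lemma 3.1 (proof, pp. 6–7)] [cite: CourantRobbins1958, Ch. V Appendix §2 (the even–odd rule)] -/
theorem kindsIn_eq_corner_corner_of_twoCrossable_cut (hh : holeFaceW w ∉ D) (hr : RootedFace D (w.side .W) (farW w))
    (h : ω.IsB2a) (hS : ω.2.firstSideG = .S) {q : ℕ → ℤ × ℤ} {c : ℕ → Face} {s : ℕ → Side} {K : ℕ} (hq0 : q 0 = w)
    (hseg : ∀ k, k < K → segment ℝ (toC (cornerPt (q k))) (toC (cornerPt (q (k + 1)))) = sideSeg (c k) (s k))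
    (h1 : ∀ k, k < K → (c k).side (s k) ≠ (holeFaceW w).side .W) (h2 : ∀ k, k < K → (c k).side (s k) ≠ w.side .W)
    (hexit : (∀ f : Face, f ∈ D → f.1 < (q K).1) ∨ (∀ f : Face, f ∈ D → (q K).1 ≤ f.1) ∨
      (∀ f : Face, f ∈ D → (q K).2 ≤ f.2) ∨ (∀ f : Face, f ∈ D → f.2 < (q K).2))
    {i k : ℕ} (hik : i < k)
    (hunc : ∀ k', k' < K → k' ≠ i → k' ≠ k → ∀ n, 1 ≤ n → n ≤ ω.2.arcs.length → ω.2.nth n ≠ (c k').side (s k'))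
    {g : Face} (hg : g ≠ farW w) {x y : Side}
    (hxy : (x = .N ∧ y = .E) ∨ (x = .E ∧ y = .N) ∨ (x = .S ∧ y = .W) ∨ (x = .W ∧ y = .S))
    (hci : (c i).side (s i) = g.side x) (hck : (c k).side (s k) = g.side y)
    (hA : ω.AJ hr h (toC (midPt (w.side .W))) ≠ 0) : ω.2.kindsIn g = [.corner, .corner] := by
  obtain ⟨m, m', -, -, -, -, -, hx, hy1, hy2, hio, -, -, -, -, hk⟩ :=
    exists_two_arcs_of_twoCrossable_cut hh hr h hS hq0 hseg h1 h2 hexit hik hunc hg hci hck hA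
  rcases hk with ⟨e1, -, -⟩ | ⟨-, a1, -⟩
  · exact e1
  · exact absurd a1 (arcKind_ne_coCorner_of_adjD x y _ _ hxy hx hy1 hy2 hio)

/-- ★★★★★ **THE MARKING LAW, uncrossed form, `(π − θ)`-corners**: `{x, y} = {N, W}` or `{S, E}` ⇒ `kindsIn g = [coCorner, coCorner]`.
[cite: GlazmanManolescu2019, §1, Fig. 1, Fig. 2] [cite: Glazman2015WeightedSAW, Lemma 3.1 (proof, pp. 6–7)]
[cite: CourantRobbins1958, Ch. V Appendix §2 (the even–odd rule)] -/
theorem kindsIn_eq_coCorner_coCorner_of_twoCrossable_cut (hh : holeFaceW w ∉ D) (hr : RootedFace D (w.side .W) (farW w))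
    (h : ω.IsB2a) (hS : ω.2.firstSideG = .S) {q : ℕ → ℤ × ℤ} {c : ℕ → Face} {s : ℕ → Side} {K : ℕ} (hq0 : q 0 = w)
    (hseg : ∀ k, k < K → segment ℝ (toC (cornerPt (q k))) (toC (cornerPt (q (k + 1)))) = sideSeg (c k) (s k))
    (h1 : ∀ k, k < K → (c k).side (s k) ≠ (holeFaceW w).side .W) (h2 : ∀ k, k < K → (c k).side (s k) ≠ w.side .W)
    (hexit : (∀ f : Face, f ∈ D → f.1 < (q K).1) ∨ (∀ f : Face, f ∈ D → (q K).1 ≤ f.1) ∨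
      (∀ f : Face, f ∈ D → (q K).2 ≤ f.2) ∨ (∀ f : Face, f ∈ D → f.2 < (q K).2))
    {i k : ℕ} (hik : i < k)
    (hunc : ∀ k', k' < K → k' ≠ i → k' ≠ k → ∀ n, 1 ≤ n → n ≤ ω.2.arcs.length → ω.2.nth n ≠ (c k').side (s k'))
    {g : Face} (hg : g ≠ farW w) {x y : Side}
    (hxy : (x = .N ∧ y = .W) ∨ (x = .W ∧ y = .N) ∨ (x = .S ∧ y = .E) ∨ (x = .E ∧ y = .S))
    (hci : (c i).side (s i) = g.side x) (hck : (c k).side (s k) = g.side y)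
    (hA : ω.AJ hr h (toC (midPt (w.side .W))) ≠ 0) : ω.2.kindsIn g = [.coCorner, .coCorner] := by
  obtain ⟨m, m', -, -, -, -, -, hx, hy1, hy2, hio, -, -, -, -, hk⟩ :=
    exists_two_arcs_of_twoCrossable_cut hh hr h hS hq0 hseg h1 h2 hexit hik hunc hg hci hck hA
  rcases hk with ⟨-, a1, -⟩ | ⟨e1, -, -⟩
  · exact absurd a1 (arcKind_ne_corner_of_adjD x y _ _ hxy hx hy1 hy2 hio)
  · exact e1

/-! ## §4 Instance: `K_S2` with the far cell's column closed below by dead or dead-end cells -/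

/-- ★★★★★ **`K_S2` (or `farSWS`) WITH THE FAR CELL'S COLUMN CLOSED BELOW BY DEAD OR DEAD-END CELLS ⇒ `farSW` DOUBLES THROUGH ITS
`(π − θ)`-CORNERS.** Hole absent; the kill-row edge `killSW.E` dead (`killSW w ∉ D ∨ (w.1 − 2, w.2 − 2) ∉ D`); a floor `Y ≤ w.2 − 2` with no
face below it; and for every row `Y ≤ y ≤ w.2 − 3` the west side of `(w.1 − 2, y)` is dead OR the cell `(w.1 − 3, y)` behind it is a dead
end (`(w.1 − 4, y)`, `(w.1 − 3, y + 1)`, `(w.1 − 3, y − 1)` absent) — the hypothesis of `StructuralKill`'s `kindsIn_farSW_eq_of_wound_under_deadEnd`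
with a floor. Then every class-`B2a` under-walk whose excursion polygon winds around the root has `kindsIn (farSW w) = [coCorner, coCorner]`.
[cite: GlazmanManolescu2019, §1, Fig. 2 («if θ = π/3, then w₂ = 0»)]
[cite: Glazman2015WeightedSAW, Lemma 3.1 (proof, pp. 6–7)] [cite: CourantRobbins1958, Ch. V Appendix §2 (the even–odd rule)] -/
theorem kindsIn_farSW_eq_of_AJ_ne_zero_under_swColumn_deadEnds (hh : holeFaceW w ∉ D)
    (hKE : killSW w ∉ D ∨ ((w.1 - 2, w.2 - 2) : Face) ∉ D) {Y : ℤ} (hY : Y ≤ w.2 - 2)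
    (hcol : ∀ y : ℤ, Y ≤ y → y ≤ w.2 - 3 → ((w.1 - 3, y) : Face) ∉ D ∨ ((w.1 - 2, y) : Face) ∉ D ∨
      (((w.1 - 4, y) : Face) ∉ D ∧ ((w.1 - 3, y + 1) : Face) ∉ D ∧ ((w.1 - 3, y - 1) : Face) ∉ D))
    (hfloor : ∀ f : Face, f ∈ D → Y ≤ f.2)
    (ω : ΩG D (w.side .W) (farW w)) (hr : RootedFace D (w.side .W) (farW w)) (h : ω.IsB2a)
    (hS : ω.2.firstSideG = .S) (hA : ω.AJ hr h (toC (midPt (w.side .W))) ≠ 0) :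
    ω.2.kindsIn (farSW w) = [.coCorner, .coCorner] := by
  set K : ℕ := (w.2 + 2 - Y).toNat with hKdef
  have hK4 : 4 ≤ K := by rw [hKdef]; omega
  have hKZ : (K : ℤ) = w.2 + 2 - Y := by rw [hKdef]; omega
  refine kindsIn_eq_coCorner_coCorner_of_twoCrossable_cut hh hr h hS
    (q := fun k => if k = 0 then (w.1, w.2) else if k = 1 then (w.1 - 1, w.2) else if k = 2 then (w.1 - 1, w.2 - 1)
      else (w.1 - 2, w.2 + 2 - k))
    (c := fun k => if k = 0 then (w.1 - 1, w.2) else if k = 1 then (w.1 - 1, w.2 - 1) else if k = 2 then (w.1 - 2, w.2 - 1)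
      else (w.1 - 2, w.2 + 1 - k))
    (s := fun k => if k = 0 ∨ k = 2 then Side.S else Side.W) (K := K)
    (by simp) (fun k hk => ?_) (fun k hk => ?_) (fun k hk => ?_) (Or.inr (Or.inr (Or.inl fun f hf => ?_)))
    (i := 1) (k := 2) one_lt_two (fun k' hk' h0 h1' => ?_) (g := farSW w) (farSW_ne_farW w) (x := .E) (y := .S)
    (Or.inr (Or.inr (Or.inr ⟨rfl, rfl⟩))) ?_ ?_ hA
  · rcases (by omega : k = 0 ∨ k = 1 ∨ k = 2 ∨ 3 ≤ k) with rfl | rfl | rfl | hk3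
    · simpa using segment_cornerPt_west ((w.1, w.2) : ℤ × ℤ)
    · simpa using segment_cornerPt_south ((w.1 - 1, w.2) : ℤ × ℤ)
    · have := segment_cornerPt_west ((w.1 - 1, w.2 - 1) : ℤ × ℤ)
      norm_num at this ⊢
      rw [show w.1 - 1 - 1 = w.1 - 2 by ring] at this
      rw [show w.2 + 2 - 3 = w.2 - 1 by ring]
      exact this
    · simp only [if_neg (show k ≠ 0 by omega), if_neg (show k ≠ 1 by omega), if_neg (show k ≠ 2 by omega),
        if_neg (show k + 1 ≠ 0 by omega), if_neg (show k + 1 ≠ 1 by omega), if_neg (show k + 1 ≠ 2 by omega),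
        show ¬(k = 0 ∨ k = 2) by omega, Nat.cast_add, Nat.cast_one]
      have := segment_cornerPt_south ((w.1 - 2, w.2 + 2 - k) : ℤ × ℤ)
      simp only at this
      rw [show w.2 + 2 - (k : ℤ) - 1 = w.2 + 1 - k by ring] at this
      rw [show w.2 + 2 - ((k : ℤ) + 1) = w.2 + 1 - k by ring]
      exact this
  · rcases (by omega : k = 0 ∨ k = 1 ∨ k = 2 ∨ 3 ≤ k) with rfl | rfl | rfl | hk3
    · obtain ⟨a, b⟩ := w; simp [holeFaceW, Face.side]
    · obtain ⟨a, b⟩ := w; simp [holeFaceW, Face.side]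
    · obtain ⟨a, b⟩ := w; simp [holeFaceW, Face.side]
    · simp only [if_neg (show k ≠ 0 by omega), if_neg (show k ≠ 1 by omega), if_neg (show k ≠ 2 by omega),
        show ¬(k = 0 ∨ k = 2) by omega, if_false]
      obtain ⟨a, b⟩ := w; simp [holeFaceW, Face.side]
  · rcases (by omega : k = 0 ∨ k = 1 ∨ k = 2 ∨ 3 ≤ k) with rfl | rfl | rfl | hk3
    · obtain ⟨a, b⟩ := w; simp [Face.side]
    · obtain ⟨a, b⟩ := w; simp [Face.side]
    · obtain ⟨a, b⟩ := w; simp [Face.side]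
    · simp only [if_neg (show k ≠ 0 by omega), if_neg (show k ≠ 1 by omega), if_neg (show k ≠ 2 by omega),
        show ¬(k = 0 ∨ k = 2) by omega, if_false]
      obtain ⟨a, b⟩ := w; simp [Face.side]
  · have := hfloor f hf
    simp only [if_neg (show K ≠ 0 by omega), if_neg (show K ≠ 1 by omega), if_neg (show K ≠ 2 by omega), hKZ]
    omega
  · -- the uncrossed edges: the hole's bottom (dead), `killSW.E` (dead), and the closed column below
    rcases (by omega : k' = 0 ∨ k' = 3 ∨ 4 ≤ k') with rfl | rfl | hk4
    · refine nth_ne_of_faces_not_mem hr h (Or.inr ?_)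
      have e : holeFaceW w = (w.1 - 1, w.2) := by obtain ⟨a, b⟩ := w; simp [holeFaceW]
      simpa [Face.side, MidEdge.faces, e] using hh
    · rcases hKE with hK | hK
      · refine nth_ne_of_faces_not_mem hr h (Or.inl ?_)
        have e : killSW w = (w.1 - 2 - 1, w.2 + 1 - ((3 : ℕ) : ℤ)) := Prod.ext (by simp [killSW]; ring) (by simp [killSW]; ring)
        norm_num [Face.side, MidEdge.faces]
        rw [e] at hK; norm_num at hK; exact hK
      · refine nth_ne_of_faces_not_mem hr h (Or.inr ?_)
        have e : ((w.1 - 2, w.2 - 2) : Face) = (w.1 - 2, w.2 + 1 - ((3 : ℕ) : ℤ)) := Prod.ext rfl (by simp; ring)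
        norm_num [Face.side, MidEdge.faces]
        rw [e] at hK; norm_num at hK; exact hK
    · simp only [if_neg (show k' ≠ 0 by omega), if_neg (show k' ≠ 1 by omega), if_neg (show k' ≠ 2 by omega),
        show ¬(k' = 0 ∨ k' = 2) by omega, if_false]
      have hk'K : (k' : ℤ) ≤ w.2 + 1 - Y := by omega
      rcases hcol (w.2 + 1 - k') (by omega) (by omega) with hd | hd | ⟨hd1, hd2, hd3⟩
      · refine nth_ne_of_faces_not_mem hr h (Or.inl ?_)
        have e : ((w.1 - 3, w.2 + 1 - k') : Face) = (w.1 - 2 - 1, w.2 + 1 - k') := Prod.ext (by simp only; ring) rfl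
        simpa [Face.side, MidEdge.faces, e] using hd
      · exact nth_ne_of_faces_not_mem hr h (Or.inr (by simpa [Face.side, MidEdge.faces] using hd))
      · -- the cell `(w.1 - 3, y)` behind the edge is a dead end: its door `E` is never crossed
        have eside : Face.side ((w.1 - 2, w.2 + 1 - (k' : ℤ)) : Face) .W = Face.side ((w.1 - 3, w.2 + 1 - (k' : ℤ)) : Face) .E := by
          simp [Face.side]; ring
        rw [eside]
        refine nth_ne_side_of_deadEnd hh hr h ?_ ?_ fun t ht => ?_
        · obtain ⟨a, b⟩ := w; simp
        · obtain ⟨a, b⟩ := w; simp [farW]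
        · cases t with
          | E => exact absurd rfl ht
          | W => left
                 have e : (Face.side ((w.1 - 3, w.2 + 1 - (k' : ℤ)) : Face) .W).faces.1 = (w.1 - 4, w.2 + 1 - k') := by
                   simp [Face.side, MidEdge.faces]; ring
                 rw [e]; exact hd1
          | S => left
                 have e : (Face.side ((w.1 - 3, w.2 + 1 - (k' : ℤ)) : Face) .S).faces.1 = (w.1 - 3, w.2 + 1 - k' - 1) := by
                   simp [Face.side, MidEdge.faces]
                 rw [e]; exact hd3
          | N => right
                 have e : (Face.side ((w.1 - 3, w.2 + 1 - (k' : ℤ)) : Face) .N).faces.2 = (w.1 - 3, w.2 + 1 - k' + 1) := by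
                   simp [Face.side, MidEdge.faces]
                 rw [e]; exact hd2
  · norm_num; obtain ⟨a, b⟩ := w; simp [farSW, Face.side]; ring
  · norm_num; obtain ⟨a, b⟩ := w; simp [farSW, Face.side]

end ΩG

end Literature.Probability.RandomPlanarGeometry.SAW.YangBaxter
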